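import Summits.QuantumFields.BalabanUV.Beta.WardBorderReflectionContact
import Summits.QuantumFields.BalabanUV.Beta.WardLocusStencils

/-!
# `BalabanUV.Beta.WardBorderReflectionWall` — binder row D1, (L4): «D1-hRhW-SOCKET-CONSISTENCY» part 2c — THE WALL INSTANCE of part 2a:
# the level-0 border contact `wallD₀` of the row-D1 owner's hR model (K-L) against the hW border Ward letter (W-B₀), multiplier legs off the axis

HONEST FRAMING (cell charter, verbatim): «discharging BetaPertH makes Balaban's UV stability UNCONDITIONAL — a real
constructive-QFT result; it is NOT the continuum limit and NOT the Clay problem.»  Neutral [folklore] bookkeeping BY NAME: part 2a's abstract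
identity `WardBorderReflectionContact.canonD_ward_eq_defect_inl_inr` with its two first-order hypotheses DISCHARGED for the wall's level-0 datum —
(H1) := the row-D1 owner an2-g20's first-order reflection law `SecondOrderBorderGaugeWall.actS_SpureRecAt_zero`; (H2) := g3's first-order Ward law
`AveragingWardRootedStencils.divV_vhSAt_inl_inr` summed over the block plus leaf-06's border dictionary `WardLocusStencils.bhKAt_inl_inr_eq_linSymAt`
(`−2γ₀ = Lc⁴`); scale `s·γ₀ = Lc⁻⁴·(−Lc⁴∕2) = −½`.  No statement of Bałaban's papers, no `[cite:]`, no `def`; instantiates NO binder of the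
β-function wall (0/4: hW, hR, D1Tel, D1Rep); NOT hW, NOT hR, NOT D1, NOT `BetaPertH`, NOT continuum, NOT Clay.
HONEST DEPENDENCY: continuum YM on T⁴ ⇐ BetaPertH ∧ nine spine estimates (0/9 proved); BetaPertH ⇐ (D1) ∧ (D4) ∧ CAP+tail;
G-an2-4 gates asym, D1 and NE2/3/4.

CONTENT (`d = 3`, odd `Lc`, `ρ_c = toSite (ctrOff 4 Lc)`, `S₀ := SpureRecAt 3 Lc ρ_c Lc⁴ (−Lc⁸∕2) cΛ 0`, `𝕄₀ := bhKStepAt 3 ρ_c Lc 0`, the END's `hγ`):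
* §1 `gamma_zero_eq` (`γ 0 = −Lc⁴∕2`), `divV_Spure0_inl_inr` (site law), **`sum_divV_Spure0_inl_inr`** = (H2) for the wall:
  `(Σ_v divV S₀ (Lc•Y+v)) (x, inl β; z, inr m) = ((−2γ₀) • conjV 𝕄₀ D_Y) (x, inl β; z, inr m)`.
* §2 **`wallD₀_ward_eq_defect_inl_inr`**: for every axis `α`, every `m ≠ α`, every block `Y`, second bond `(κ′, u′)` and entry `(x, inl β; z, inr m)`:
  `(Lc⁻⁴ • Σ_v divV (κ u ↦ wallD₀ Lc cΛ γ α κ u κ′ u′) (Lc•Y+v)) (e) = (ε_α(κ′) • refK_α (conjV (S₀ κ′ (bref α κ′ u′)) D_{sref α Y}) − conjV (S₀ κ′ u′) D_Y) (e)`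
  — the hR contact's block Ward divergence IS the reflection defect of the hW first-order datum there: the two typed border sockets of row D1
  (K-I's reflection letter, leaf-06's Ward letter (W-B₀) at level 0) are JOINTLY CONSISTENT at these entries.
NOT HERE: the mirror block, the `inr α` legs (part 2b), the `Bwall = bdB wallD₀` ∕ `c′•vhSAt` respellings for the ENDs' literal binders.
Provenance: β sub-cell, D1 formalisation swarm, unit b2b-balaban-beta-d1-formalise-leaf-04 gen 4, 2026-08-20 (v1); no existing file touched.
-/

open Finset
open scoped BigOperators
open Literature.MathematicalPhysics.QuantumFieldTheory
open Literature.MathematicalPhysics.QuantumFieldTheory.Balaban1983to89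
open Literature.MathematicalPhysics.QuantumFieldTheory.Balaban1983to89.Beta
open ExpKernelCalculus (MKer)
open AffineAveraging (box toSite)
open AveragingContours (blk off)
open AveragingContoursRooted (ctr ctrOff)
open AveragingHessianKernelsRooted (vhSAt linKerAt)
open KernelWard (divV)
open PolarizationSign (reflSign)
open KernelReflection (LegMap refK refK_apply)
open ResolventReflection (sref bref mref Φ)
open OneStepResolventKernel (Fib)
open StepJetData (wilsonA)
open BalabanStepJetsSucc (wE wVH)
open Summit.QuantumFields.BalabanUV.Beta.TameKernelCalculus
open Summit.QuantumFields.BalabanUV.Beta.ChartConjugation (conjV)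
open Summit.QuantumFields.BalabanUV.Beta.BorderedHessian (diagK diagK_apply conjV_diagK_apply ctGen bhKAt bhKStepAt bhKStepAt_zero stepScale)
open Summit.QuantumFields.BalabanUV.Beta.AveragingWardRootedStencils (linSymAt legInd divV_vhSAt_inl_inr)
open Summit.QuantumFields.BalabanUV.Beta.WardLocusStencils (bhKAt_inl_inr_eq_linSymAt)
open Summit.QuantumFields.BalabanUV.Beta.WilsonReflectionContact (wilsonA_inl_inr)
open Summit.QuantumFields.BalabanUV.Beta.SpineRooted (SpureRecAt SpureRecAt_zero_level)
open Summit.QuantumFields.BalabanUV.Beta.SecondOrderBorderGauge (actS canonD)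
open Summit.QuantumFields.BalabanUV.Beta.SecondOrderBorderGaugeWall (wallD₀ actS_SpureRecAt_zero)
open Summit.QuantumFields.BalabanUV.Beta.WardBorderReflectionContact (canonD_ward_eq_defect_inl_inr dSym_inl dSym_inr)

namespace Summit.QuantumFields.BalabanUV.Beta.WardBorderReflectionWall

noncomputable section

variable {Lc : ℕ} [NeZero Lc]

/-! ## §1 The first-order block Ward law (H2) for the wall's level-0 datum -/

/-- [folklore] Under the END's `hγ`, `γ 0 = −Lc⁴∕2`. -/
theorem gamma_zero_eq (γ : ℕ → ℝ) (hγ : ∀ j, γ j = -((Lc : ℝ) ^ 8 / 2) * wVH 3 Lc j / (stepScale 3 Lc j * (Lc : ℝ) ^ 4)) :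
    γ 0 = -((Lc : ℝ) ^ 4 / 2) := by
  have hL : (Lc : ℝ) ≠ 0 := by exact_mod_cast NeZero.ne Lc
  rw [hγ 0]
  simp only [BalabanStepJetsSucc.wVH, BorderedHessian.stepScale, pow_zero, one_pow, mul_one, one_mul]
  field_simp

/-- [folklore] **SITE LAW** at a border entry `(x, inl β; z, inr m)`: `divV S₀ y (e) = ([z + ρ_c = y] − [x = y]) · (−Lc⁸∕2) · linSymAt ρ_c Lc (e)`
(`wilsonA` is silent on the border; g3's `divV_vhSAt_inl_inr`). -/
theorem divV_Spure0_inl_inr (cΛ : ℝ) (y x z : Fin 4 → ℤ) (β m : Fin 4) :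
    divV (SpureRecAt 3 Lc (toSite (ctrOff 4 Lc)) ((Lc : ℝ) ^ 4) (-((Lc : ℝ) ^ 8 / 2)) cΛ 0) y x z (Sum.inl β) (Sum.inr m) =
      ((if z + toSite (ctrOff 4 Lc) = y then (1 : ℝ) else 0) - (if x = y then 1 else 0)) *
        (-((Lc : ℝ) ^ 8 / 2) * linSymAt (toSite (ctrOff 4 Lc)) Lc x z (Sum.inl β) (Sum.inr m)) := by
  have hL : 1 ≤ Lc := Nat.one_le_iff_ne_zero.mpr (NeZero.ne Lc)
  have hv := divV_vhSAt_inl_inr (d := 3) hL (toSite (ctrOff 4 Lc)) y x z β m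
  simp only [KernelWard.divV, Finset.sum_apply, Pi.sub_apply] at hv ⊢
  simp only [SpureRecAt_zero_level, Pi.add_apply, Pi.smul_apply, smul_eq_mul, wilsonA_inl_inr, mul_zero, zero_add]
  have : ∑ κ : Fin 4, ((-((Lc : ℝ) ^ 8 / 2)) * vhSAt (toSite (ctrOff 4 Lc)) 3 Lc rfl κ (y - B6BondElimination.unitVec κ) x z (Sum.inl β) (Sum.inr m) -
      (-((Lc : ℝ) ^ 8 / 2)) * vhSAt (toSite (ctrOff 4 Lc)) 3 Lc rfl κ y x z (Sum.inl β) (Sum.inr m)) =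
      (-((Lc : ℝ) ^ 8 / 2)) * ∑ κ : Fin 4, (vhSAt (toSite (ctrOff 4 Lc)) 3 Lc rfl κ (y - B6BondElimination.unitVec κ) x z (Sum.inl β) (Sum.inr m) -
        vhSAt (toSite (ctrOff 4 Lc)) 3 Lc rfl κ y x z (Sum.inl β) (Sum.inr m)) := by
    rw [Finset.mul_sum]; refine Finset.sum_congr rfl fun κ _ => ?_; ring
  rw [this, hv]
  ring

/-- [folklore] **(H2) FOR THE WALL**: the block Ward law of `S₀` at the border entries `(x, inl β; z, inr m)` in the form consumed by part 2a,
`(Σ_v divV S₀ (Lc•Y+v)) (e) = ((−2γ₀) • conjV 𝕄₀ D_Y) (e)` (`𝕄₀ (x, inl β; z, inr m) = −Lc⁴·linSymAt (e)`, `−2γ₀ = Lc⁴`). -/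
theorem sum_divV_Spure0_inl_inr (cΛ : ℝ) (γ : ℕ → ℝ)
    (hγ : ∀ j, γ j = -((Lc : ℝ) ^ 8 / 2) * wVH 3 Lc j / (stepScale 3 Lc j * (Lc : ℝ) ^ 4)) (Y x z : Fin 4 → ℤ) (β m : Fin 4) :
    (∑ v ∈ box 4 Lc, divV (SpureRecAt 3 Lc (toSite (ctrOff 4 Lc)) ((Lc : ℝ) ^ 4) (-((Lc : ℝ) ^ 8 / 2)) cΛ 0) ((Lc : ℤ) • Y + toSite v))
        x z (Sum.inl β) (Sum.inr m) =
      ((-2 * γ 0) • conjV (bhKStepAt 3 (toSite (ctrOff 4 Lc)) Lc 0)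
        (diagK ((1 / 2 : ℝ) • ∑ v ∈ box 4 Lc, legInd (toSite (ctrOff 4 Lc)) ((Lc : ℤ) • Y + toSite v)))) x z (Sum.inl β) (Sum.inr m) := by
  rw [Finset.sum_apply, Finset.sum_apply, Finset.sum_apply, Finset.sum_apply]
  simp only [divV_Spure0_inl_inr]
  rw [← Finset.sum_mul, Finset.sum_sub_distrib, Pi.smul_apply, Pi.smul_apply, Pi.smul_apply, Pi.smul_apply, smul_eq_mul,
    conjV_diagK_apply, dSym_inl, dSym_inr, bhKStepAt_zero, bhKAt_inl_inr_eq_linSymAt, gamma_zero_eq γ hγ]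
  ring

/-! ## §2 The consistency identity for the wall's level-0 contact, multiplier legs off the axis -/

/-- [folklore] **THE WALL INSTANCE OF PART 2a**: for every reflection axis `α`, every multiplier direction `m ≠ α`, every block `Y`, second jet bond
`(κ′, u′)` and entry `e = (x, inl β; z, inr m)`:
`(Lc⁻⁴ • Σ_v divV (κ u ↦ wallD₀ Lc cΛ γ α κ u κ′ u′) (Lc•Y+v)) (e) = (ε_α(κ′) • refK_α (conjV (S₀ κ′ (bref α κ′ u′)) D_{sref α Y}) − conjV (S₀ κ′ u′) D_Y) (e)` —
the level-0 hR contact's block Ward divergence equals the reflection defect of the hW first-order Ward datum at these entries (the consistency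
identities of `WardBorderReflection.joint_consistency_necessary` hold there). -/
theorem wallD₀_ward_eq_defect_inl_inr (hLc : Odd Lc) (cΛ : ℝ) (γ : ℕ → ℝ)
    (hγ : ∀ j, γ j = -((Lc : ℝ) ^ 8 / 2) * wVH 3 Lc j / (stepScale 3 Lc j * (Lc : ℝ) ^ 4)) (α : Fin 4) {m : Fin 4} (hm : m ≠ α)
    (Y : Fin 4 → ℤ) (κ' : Fin 4) (u' x z : Fin 4 → ℤ) (β : Fin 4) :
    ((((Lc : ℝ) ^ 4)⁻¹) • ∑ v ∈ box 4 Lc, divV (fun κ u => wallD₀ Lc cΛ γ α κ u κ' u') ((Lc : ℤ) • Y + toSite v)) x z (Sum.inl β) (Sum.inr m) =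
      (reflSign α κ' • refK (Φ (d := 3) Lc α)
          (conjV (SpureRecAt 3 Lc (toSite (ctrOff 4 Lc)) ((Lc : ℝ) ^ 4) (-((Lc : ℝ) ^ 8 / 2)) cΛ 0 κ' (bref α κ' u'))
            (diagK ((1 / 2 : ℝ) • ∑ v ∈ box 4 Lc, legInd (toSite (ctrOff 4 Lc)) ((Lc : ℤ) • sref α Y + toSite v)))) -
        conjV (SpureRecAt 3 Lc (toSite (ctrOff 4 Lc)) ((Lc : ℝ) ^ 4) (-((Lc : ℝ) ^ 8 / 2)) cΛ 0 κ' u')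
          (diagK ((1 / 2 : ℝ) • ∑ v ∈ box 4 Lc, legInd (toSite (ctrOff 4 Lc)) ((Lc : ℤ) • Y + toSite v))))
        x z (Sum.inl β) (Sum.inr m) := by
  have hL : (Lc : ℝ) ≠ 0 := by exact_mod_cast NeZero.ne Lc
  have hs : ((Lc : ℝ) ^ 4)⁻¹ * γ 0 = -(1 / 2 : ℝ) := by
    rw [gamma_zero_eq γ hγ]; field_simp
  exact canonD_ward_eq_defect_inl_inr Lc α (γ 0) (((Lc : ℝ) ^ 4)⁻¹) (bhKStepAt 3 (toSite (ctrOff 4 Lc)) Lc 0)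
    (SpureRecAt 3 Lc (toSite (ctrOff 4 Lc)) ((Lc : ℝ) ^ 4) (-((Lc : ℝ) ^ 8 / 2)) cΛ 0) hLc hm hs
    (actS_SpureRecAt_zero hLc cΛ γ hγ α) (fun Y x z β => sum_divV_Spure0_inl_inr cΛ γ hγ Y x z β m) Y κ' u' x z β

end

end Summit.QuantumFields.BalabanUV.Beta.WardBorderReflectionWall
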